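import Literature.NumberTheory.EllipticCurves.ComplexMultiplicationCoatesWilesReductionIndexProofs
import Literature.NumberTheory.EllipticCurves.CanonicalPAdicHeightLeavesProofs
import Literature.NumberTheory.EllipticCurves.ModPReducibility
import Literature.NumberTheory.EllipticCurves.MordellWeilProofs
import Literature.NumberTheory.EllipticCurves.Rank1Residual.PrintShape
import Literature.NumberTheory.EllipticCurves.SerreOpenImageOrdinaryInertiaProofs
import HarnessLib

/-!
# Rational torsion is killed by `#Ẽ(𝔽_p)` at a good prime `p ≥ 3`; a rational point of order `p`
# forces `a_p ≡ 1 (mod p)` (the prime is *anomalous*)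

Topic `Literature/NumberTheory/EllipticCurves`; `Proofs`-style file (THEOREMS ONLY: no definition, no
named fact, no instance). Cell `b2b-bsdres` (run/shared/lean/b2b/bsd-rank1-residual/), HONEST FRAMING:
the cell deletes the COMBINATION-SHAPED residual classes of the rank-`≤ 1` BSD formula from PUBLISHED
theorems only and types the rest; this is not "finishing BSD". This file supplies the one elementary
lemma the cell's good-Eisenstein boundary files were missing (docstring item 8 of
`CastellaGrossiSkinner2025/EisensteinPPartBSD.lean`: "the tree has no lemma 'reducible ∧
non-anomalous ⇒ `p ∤ #E(ℚ)_tors`', so the consumer theorems carry `p ∤ #E(ℚ)_tors` as an explicit,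
per-pair decidable binder `htors`"); with it that binder is discharged
(`Rank1Residual/EisensteinGoodComplement.lean`, appended).

## Statements (for `W/ℚ` a globally minimal elliptic curve, `p ≥ 3` a prime of good reduction,
## `N_p = #Ẽ(𝔽_p) = W.reductionPointCount p`, `a_p = W.frobeniusTrace p = p + 1 - N_p`)

* `reductionPointCount_nsmul_eq_zero_of_isOfFinAddOrder` — **`N_p · T = O` for every torsion point
  `T ∈ E(ℚ)`**: the reduction `E(ℚ_p) → Ẽ(𝔽_p)` is a homomorphism with kernel `E₁(ℚ_p)` (Silverman,
  *AEC* VII.2.1), so `N_p · T ∈ E₁(ℚ_p)` (tree theorem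
  `WeierstrassCurve.isInReductionKernel_reductionPointCount_nsmul`, Coates–Wiles' "`βE(K_𝔭) ⊆ E₁(K_𝔭)`");
  and `E₁(ℚ_p) ∩ E(ℚ)` has no torsion for `p` odd (AEC VII.3.4 / IV.6.1 with `v(p) = 1 < p - 1`; tree
  theorem `not_isOfFinAddOrder_of_one_lt_padicNorm_holds`, by division polynomials), so the torsion point
  `N_p · T` is `O`. Hence `addOrderOf T ∣ N_p` (`addOrderOf_dvd_reductionPointCount`) — the
  divisibility behind "`E(ℚ)_tors ↪ Ẽ(𝔽_p)` for `p ∤ 2Δ`" (AEC VII.3.1(b) + VIII.7.1).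
* `dvd_reductionPointCount_of_dvd_torsionOrder` — `p ∣ #E(ℚ)_tors ⇒ p ∣ N_p` (Cauchy's theorem in the
  finite group `E(ℚ)_tors`, tree `finite_torsion_point`).
* `dvd_frobeniusTrace_sub_one_of_dvd_torsionOrder`, `…_of_addOrderOf_eq` — **a rational point of order
  `p` at a good prime `p ≥ 3` makes `p` ANOMALOUS: `a_p ≡ 1 (mod p)`** (`p ∣ N_p = p + 1 - a_p`; Mazur,
  *Rational points of abelian varieties with values in towers of number fields*, Invent. Math. 18
  (1972), §1 ("anomalous primes"); Silverman AEC VII.3.1, Ex. 5.14). With the tree's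
  `not_exists_addOrderOf_eq_of_hasIrreducibleModPGaloisRep` (`E[p]` is then reducible) this is the
  sentence "rational `p`-torsion ⇒ `p` is an anomalous Eisenstein prime" used in the cell's class X1.
* `not_dvd_torsionOrder_of_not_dvd_frobeniusTrace_sub_one` — contrapositive, the form consumed by the
  cell: `a_p ≢ 1 (mod p)` (good `p ≥ 3`) ⇒ `p ∤ #E(ℚ)_tors`.

No `p = 2` statement (there `E₁(ℚ_2)` may contain `2`-torsion: `v(2) = 1 = p - 1`).

## References
* J. H. Silverman, *The Arithmetic of Elliptic Curves*, 2nd ed., GTM 106 (2009), VII.2.1, VII.3.1,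
  VII.3.4, IV.6.1, VIII.7.1. [SilvermanAEC2009]
* B. Mazur, Invent. Math. 18 (1972) 183–266, §1 (anomalous primes). [Mazur1972]
-/

noncomputable section

open scoped Classical

open WeierstrassCurve

namespace Literature.NumberTheory.EllipticCurves

variable (W : WeierstrassCurve ℚ) [W.IsElliptic] [W.IsGloballyMinimal] (p : ℕ) [Fact p.Prime]

omit [W.IsGloballyMinimal] in
/-- Cauchy's theorem in `E(ℚ)_tors` (a finite group over a number field, tree `finite_torsion_point`):
`p ∣ #E(ℚ)_tors` gives a rational point of order `p`. [folklore] -/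
theorem exists_addOrderOf_eq_of_dvd_torsionOrder
    (h : p ∣ W.torsionOrder) : ∃ T : W.toAffine.Point, addOrderOf T = p := by
  haveI := W.finite_torsion_point
  unfold WeierstrassCurve.torsionOrder at h
  obtain ⟨t, ht⟩ := exists_prime_addOrderOf_dvd_card' p h
  -- the order of `t` in `E(ℚ)` for the classical group-law instance, then for the computable one
  have ht' := (@AddSubgroup.addOrderOf_coe _ (@AddCommGroup.toAddGroup _
    (@WeierstrassCurve.Affine.Point.instAddCommGroup ℚ _ W.toAffine
      fun a b => Classical.propDecidable (a = b))) _ t).trans ht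
  exact ⟨(t : W.toAffine.Point), (Rank1Residual.addOrderOf_point_eq_of_subsingleton W _ _ _).trans ht'⟩

/-- **`#Ẽ(𝔽_p)` kills the rational torsion at a good prime `p ≥ 3`.** For `W/ℚ` globally minimal
elliptic, `p ≥ 3` with `p ∤ Δ_W` and a torsion point `T ∈ E(ℚ)`: `N_p · T = O`, `N_p = #Ẽ(𝔽_p)`.
Proof: `N_p · T ∈ E₁(ℚ_p)` (AEC VII.2.1, tree `isInReductionKernel_reductionPointCount_nsmul`) is a
torsion point, and `E₁(ℚ_p) ∩ E(ℚ)` is torsion-free for `p` odd (AEC VII.3.4/IV.6.1, tree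
`not_isOfFinAddOrder_of_one_lt_padicNorm_holds`). [cite: SilvermanAEC2009, VII.3.1(b) and VII.3.4] -/
theorem reductionPointCount_nsmul_eq_zero_of_isOfFinAddOrder (hp : 3 ≤ p)
    (hΔ : ¬ (p : ℤ) ∣ minimalDiscriminantInt W) {T : W.toAffine.Point} (hT : IsOfFinAddOrder T) :
    W.reductionPointCount p • T = 0 := by
  have hker := W.isInReductionKernel_reductionPointCount_nsmul p hΔ (W.toPadicPoint p T)
  rw [← map_nsmul] at hker
  have hfin : IsOfFinAddOrder (W.reductionPointCount p • T) := hT.nsmul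
  rcases hQ : W.reductionPointCount p • T with _ | ⟨x, y, h⟩
  · rfl
  · exfalso
    rw [hQ, toPadicPoint_some, isInReductionKernel_some] at hker
    rw [hQ] at hfin
    exact not_isOfFinAddOrder_of_one_lt_padicNorm_holds W p hp h hker hfin

/-- **The order of a rational torsion point divides `#Ẽ(𝔽_p)`** at a good prime `p ≥ 3`
(`p ∤ Δ_W`): `addOrderOf T ∣ N_p` — the divisibility content of "`E(ℚ)_tors` injects into
`Ẽ(𝔽_p)`" (Silverman AEC VII.3.1(b), VIII.7.1). [cite: SilvermanAEC2009, VII.3.1(b)] -/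
theorem addOrderOf_dvd_reductionPointCount (hp : 3 ≤ p)
    (hΔ : ¬ (p : ℤ) ∣ minimalDiscriminantInt W) {T : W.toAffine.Point} (hT : IsOfFinAddOrder T) :
    addOrderOf T ∣ W.reductionPointCount p :=
  addOrderOf_dvd_of_nsmul_eq_zero (reductionPointCount_nsmul_eq_zero_of_isOfFinAddOrder W p hp hΔ hT)

/-- **A rational point of order `p` gives `p ∣ #Ẽ(𝔽_p)`** at a good prime `p ≥ 3` (`p ∤ Δ_W`).
[cite: SilvermanAEC2009, VII.3.1(b)] -/
theorem dvd_reductionPointCount_of_addOrderOf_eq (hp : 3 ≤ p)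
    (hΔ : ¬ (p : ℤ) ∣ minimalDiscriminantInt W) {T : W.toAffine.Point} (hT : addOrderOf T = p) :
    p ∣ W.reductionPointCount p := by
  have hfin : IsOfFinAddOrder T := addOrderOf_pos_iff.mp (by rw [hT]; exact (Fact.out : p.Prime).pos)
  exact hT ▸ addOrderOf_dvd_reductionPointCount W p hp hΔ hfin

/-- **`p ∣ #E(ℚ)_tors ⇒ p ∣ #Ẽ(𝔽_p)`** at a good prime `p ≥ 3` (`p ∤ Δ_W`): Cauchy's theorem in the
finite group `E(ℚ)_tors` (tree `finite_torsion_point`) gives a rational point of order `p`.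
[cite: SilvermanAEC2009, VII.3.1(b) and VIII.7.1] -/
theorem dvd_reductionPointCount_of_dvd_torsionOrder (hp : 3 ≤ p)
    (hΔ : ¬ (p : ℤ) ∣ minimalDiscriminantInt W) (h : p ∣ W.torsionOrder) :
    p ∣ W.reductionPointCount p := by
  obtain ⟨T, hT⟩ := exists_addOrderOf_eq_of_dvd_torsionOrder W p h
  exact dvd_reductionPointCount_of_addOrderOf_eq W p hp hΔ hT

omit [W.IsElliptic] [Fact p.Prime] in
/-- Bookkeeping: `p ∣ N_p ⇔ a_p ≡ 1 (mod p)` (`a_p = p + 1 - N_p`). [folklore] -/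
theorem dvd_reductionPointCount_iff_dvd_frobeniusTrace_sub_one :
    p ∣ W.reductionPointCount p ↔ (p : ℤ) ∣ W.frobeniusTrace p - 1 := by
  rw [← dvd_frobeniusTrace_sub_iff W p p]
  have h : W.frobeniusTrace p - 1 = (W.frobeniusTrace p - (p + 1)) + p := by ring
  constructor
  · intro hd
    rw [h]
    exact dvd_add hd dvd_rfl
  · intro hd
    have h' : W.frobeniusTrace p - (p + 1) = (W.frobeniusTrace p - 1) - p := by ring
    rw [h']
    exact dvd_sub hd dvd_rfl

/-- **A rational point of order `p` at a good prime `p ≥ 3` makes `p` anomalous: `a_p ≡ 1 (mod p)`**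
(`p ∣ #Ẽ(𝔽_p) = p + 1 - a_p`). Mazur 1972 §1; Silverman AEC VII.3.1, V.2.
[cite: SilvermanAEC2009, VII.3.1(b)] -/
theorem dvd_frobeniusTrace_sub_one_of_addOrderOf_eq (hp : 3 ≤ p)
    (hgood : W.HasGoodReductionAtPrime p) {T : W.toAffine.Point} (hT : addOrderOf T = p) :
    (p : ℤ) ∣ W.frobeniusTrace p - 1 :=
  (dvd_reductionPointCount_iff_dvd_frobeniusTrace_sub_one W p).mp
    (dvd_reductionPointCount_of_addOrderOf_eq W p hp
      (not_dvd_minimalDiscriminantInt_of_hasGoodReductionAtPrime' W p hgood) hT)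

/-- **`p ∣ #E(ℚ)_tors` at a good prime `p ≥ 3` makes `p` anomalous: `a_p ≡ 1 (mod p)`.**
[cite: SilvermanAEC2009, VII.3.1(b) and VIII.7.1] -/
theorem dvd_frobeniusTrace_sub_one_of_dvd_torsionOrder (hp : 3 ≤ p)
    (hgood : W.HasGoodReductionAtPrime p) (h : p ∣ W.torsionOrder) :
    (p : ℤ) ∣ W.frobeniusTrace p - 1 :=
  (dvd_reductionPointCount_iff_dvd_frobeniusTrace_sub_one W p).mp
    (dvd_reductionPointCount_of_dvd_torsionOrder W p hp
      (not_dvd_minimalDiscriminantInt_of_hasGoodReductionAtPrime' W p hgood) h)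

/-- **Contrapositive, the form the cell consumes: at a good prime `p ≥ 3` with `a_p ≢ 1 (mod p)`
(non-anomalous), `p ∤ #E(ℚ)_tors`.** [cite: SilvermanAEC2009, VII.3.1(b)] -/
theorem not_dvd_torsionOrder_of_not_dvd_frobeniusTrace_sub_one (hp : 3 ≤ p)
    (hgood : W.HasGoodReductionAtPrime p) (hna : ¬ (p : ℤ) ∣ W.frobeniusTrace p - 1) :
    ¬ p ∣ W.torsionOrder :=
  fun h ↦ hna (dvd_frobeniusTrace_sub_one_of_dvd_torsionOrder W p hp hgood h)

omit [W.IsGloballyMinimal] in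
/-- **Rational `p`-torsion makes `E[p]` reducible** (the line spanned by the point is `Γ_ℚ`-stable;
Mazur 1977 p. 157), `#E(ℚ)_tors` form: `p ∣ #E(ℚ)_tors ⇒ ¬ (E[p] irreducible)`. Cauchy in
`E(ℚ)_tors` + tree `not_exists_addOrderOf_eq_of_hasIrreducibleModPGaloisRep`.
[cite: Mazur1977, Ch. III §5, p. 157] -/
theorem not_hasIrreducibleModPGaloisRep_of_dvd_torsionOrder (h : p ∣ W.torsionOrder) :
    ¬ W.HasIrreducibleModPGaloisRep p := by
  intro hirr
  obtain ⟨T, hT⟩ := exists_addOrderOf_eq_of_dvd_torsionOrder W p h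
  exact not_exists_addOrderOf_eq_of_hasIrreducibleModPGaloisRep W hirr
    ⟨T, (Rank1Residual.addOrderOf_point_eq_of_subsingleton W _ _ _).trans hT⟩

end Literature.NumberTheory.EllipticCurves

end
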